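import Summits.QuantumFields.YangMills.Theorems.BalabanUVNodesN07SplitClauseLevelRaisingMargin
import HarnessLib

/-!
# N07 [B11] (= [15] = [Balaban1985Variational]) Sect. F, S6 HEAD — LEVEL RAISING WITH A MARGIN OF ANY WIDTH `w` (repair of ⚑ LOCATED-MARGIN-WIDTH, referee ref-G READ454∕455 on
# MODULES 64∕65a∕65b): the guarded per-datum token from its restriction to the datums whose print box WIDENED BY `w` LEVEL-`j` BLOCKS ON EACH SIDE misses `Ω_{j+1}`; at `w = 2ρ` the
# widened box IS print's margin cube «□̃» of (144) ∕ [6] p. 98 (`B8Eq131Cubes.tcube`), and it CONTAINS the chart's whole top box (= print box + `ρ + 1` blocks)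

Cell `pub-ymgap`, seat `pub-ymgap-dag-n07-e` g24 (FAN-OUT §N07 row s3; LANE OWNER of the K0 road), MODULE 66.  `--kind proof --supports stmt-QuantumFields-20541 --as helper` (K0⁷);
count-neutral; def-free.  [15] = [Balaban1985Variational]; [6] = [Balaban1985RegularSpaces].

WHY (referee ref-G READ454 NOTE-1 ⚑ LOCATED-MARGIN-WIDTH, cell STATUS 2026-08-28T20:16:15Z; READ455).  MODULE 64 (`…N07SplitClauseLevelRaisingMargin`, p662272) typed plan g87's cure (c2) of
LOCATED-ADJACENT-RING with a margin of ONE level-`j` block (`box L (cornerP − 1) (sideP + 2) j`).  But the chart's top box — the box MODULE 62's letter `δ̂` is read on,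
`[sqLo_j − 1, sqHi_j + 1]` — is the print box widened by `ρ + 1` blocks (`sqLo L a ρ j j = a − ρ` since `gs L 0 = 1`), and print's margin cube «□̃» of (144) («dist(□̃, □ᶜ) = 2K₁M₁Lʲη») ∕ [6] p. 98
(«a distance of its boundary to □ is equal to 2R₁M₁») is the print box widened by `2ρ` blocks (`B8Eq131Cubes.tLo a ρ = a − 2ρ`).  So at a datum that is margin-clean AS TYPED in MODULES 64∕65,
`Ω_{j+1}` may still meet the ring of blocks `2 … ρ + 1` around the print box, and there the adjacent-ring obstruction is not cleared: the cure was INCOMPLETE IN SCOPE (the theorems stand).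
THIS FILE re-types MODULE 64 with the margin width a PARAMETER `w`: the block tolerance of the level raising (§1 ★★) holds as soon as `2w + 2ρ ≤ ρ·L + 1` — with the finer level-`(j+1)`
corner `ρ·⌊(ρq − w)∕(Lρ)⌋` the left inequality is free and the right one reads `2w ≤ ρ((L − 1)(s − 1) − 1) + 1`, `sideP = ρs`, `s ≥ 2` (NO proviso on `ρ` versus `Mc`); in Bałaban's family
`L > 11` (`T4Family.hL11`), so every `w ≤ 5ρ` is tolerated, in particular the chart's `ρ + 1` and print's `2ρ`.  §1 also records the dictionary: the `w`-widened print box is the depth-`n`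
margin box of `B8Eq131Cubes` with margin `Lⁿ·w`; at `w = ρ` it is `□_n` (`cube … n n`), at `w = 2ρ` it is «□̃» (`tcube`) BY NAME; the chart's box at EVERY level `j′ ≤ n`
(`[sqLo_{j′} − 1, sqHi_{j′} + 1]`, blown up to the fine lattice) lies in the `2ρ`-widened print box (`ρ·gs L (n − j′) + 1 ≤ 2ρ·L^{n−j′}`, [6] p. 98's geometric sum).  §2–§3 are MODULE 64 §2–§3
verbatim with `− w ∕ + 2w`; §3 adds the PRINT corollary at `w = 2ρ` (tolerance from `F.hL11`), which the knit of record's wide edition (MODULE 67a) consumes.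

WHAT IS PROVED (sorry-free; no definition; axioms standard; integer box arithmetic + MODULE 56's `.raise` by name — NOTHING of [15]∕[6] analysis).
§1 `box_subset_wbox_width` · `wbox_mono` · `mem_wbox_iff_inBox_margin` · `wbox_rho_eq_cube_top` (= □_n) · ★ `wbox_two_mul_eq_tcube` (= □̃) · `chartTopBox_subset_wboxPrint` ·
★ `blowup_chartBox_subset_wboxPrint` (every level) · ★★ `exists_cornerP_wbox_subset_succ_of_width` (the block tolerance, `1 ≤ Mc ≤ ρ`, `2w + 2ρ ≤ ρL + 1`).
§2 ★★★ `localGaugeSplitOn_allDatums_of_marginClean_width` (generic torus, any `Ω`, any `U`: all meeting datums from the width-`w` margin-clean meeting datums).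
§3 ★★★ `datumGaugeSplitTopStepCoreG_of_marginClean_width F N` (generic `w`, side letter `2w + 2ρ ≤ ρ·L + 1`) · ★★★ `datumGaugeSplitTopStepCoreG_of_marginCleanPrint F N` (`w = 2ρ`,
no side letter beyond `1 ≤ Mc ≤ ρ`: `6ρ ≤ ρL + 1` from `L > 11`).

HONEST SCOPE.  Count-neutral; a reduction between displayed shapes; the clause itself (S3 + chart + budget) is discharged by nobody here; MODULES 64∕65a∕65b are NOT claimed false (they are
the `w = 1` instances, correct and conditional); stub 1-G‴ ∕ K0⁷ ∕ K1⁹ NOT closed; N07 NOT discharged; counts unmoved (typed 28∕28 · discharged 5∕27); one finite 𝕋⁴ programme at fixed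
ε — the route closes the conditional finite-𝕋⁴ rung `BalabanLadder.UV` ONLY; the YM mass gap (Clay) is NOT proved by any of this; nothing continuum ∕ ℝ⁴ ∕ OS.  No `sorry`, no `def`, no
`instance`, no `notation`.  RELATED, NOT DUPLICATED (BY NAME): MODULE 64 `box_subset_wbox` ∕ `exists_cornerP_wbox_subset_succ` (the `w = 1` case) ∕ `localGaugeSplitOn_allDatums_of_marginClean`
∕ `datumGaugeSplitTopStepCoreG_of_marginClean`; MODULE 56 `box_subset_box_succ_of_corner` ∕ `.raise` ∕ `cubeExt_side_subset_box_cornerP`; `B8Eq131Cubes.tcube_eq ∕ cube_eq ∕ margin_own ∕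
inBox_margin_mono`; 36a `box_subset_box_of_corner ∕ cornerP ∕ sideP ∕ gridFloor`.

References: [15] (144) p. 300, p. 300 («□ intersecting Ω_j but not Ω_{j+1}»), (147)–(150) p. 301, (160) p. 303, (165)–(168) p. 304, Prop. 8 p. 304; [6] p. 98, (1.131) p. 99.
-/

set_option autoImplicit false

noncomputable section
open scoped BigOperators Matrix.Norms.L2Operator

namespace Summit.QuantumFields.YangMills.BalabanUVNodes.N07SplitClauseLevelRaisingMarginWide

open Literature.MathematicalPhysics.QuantumFieldTheory.Balaban1983to89
open Literature.MathematicalPhysics.QuantumFieldTheory.Balaban1983to89.Node00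
open Literature.MathematicalPhysics.QuantumFieldTheory.Balaban1983to89.B15DeterminingSets
open T4Continuum (T4Family)
open B15Eq112TorusCover (cover)
open B14DomainGeom (Pt Within)
open B14.Eq213MaximalDomains (side cubeExt)
open B7Prop1Local (InBox)
open B8Ineq130 (tlo thi tlo_apply thi_apply)
open B8Eq131Cubes (box bLo bHi gs sqLo sqHi cube tcube)
open Summit.QuantumFields.YangMills.BalabanUVNodes.N07LocalLettersSplitCore (LocalGaugeSplitOn)
open Summit.QuantumFields.YangMills.BalabanUVNodes.N07LocalLettersCoreGuarded (DatumGaugeSplitTopStepCoreG)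
open Summit.QuantumFields.YangMills.BalabanUVNodes.N07SplitClauseLevelRaising (box_subset_box_succ_of_corner cubeExt_side_subset_box_cornerP)

/-! ## §1  The print box widened by `w` level-`n` blocks: dictionary with □_n ∕ □̃, the chart's boxes, and the block tolerance -/

section Boxes

variable {d : ℕ}

/-- The print box lies in its widening by `w` blocks on each side: `box L c S n ⊆ box L (c − w) (S + 2w) n`. [cite: Balaban1985Variational, (144) p.300 (bookkeeping)] -/
theorem box_subset_wbox_width (L : ℕ) (c : Pt d) (S n w : ℕ) : box L c S n ⊆ box L (c - (w : Pt d)) (S + 2 * w) n :=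
  box_subset_box_of_corner L (fun i => by simp) (fun i => by simp only [Pi.sub_apply, Pi.natCast_apply]; push_cast; linarith) n

/-- The widening is monotone in the width: `w ≤ w′ ⇒ box L (c − w) (S + 2w) n ⊆ box L (c − w′) (S + 2w′) n`. [cite: Balaban1985Variational, (144) p.300 (bookkeeping)] -/
theorem wbox_mono (L : ℕ) (c : Pt d) (S n : ℕ) {w w' : ℕ} (h : w ≤ w') : box L (c - (w : Pt d)) (S + 2 * w) n ⊆ box L (c - (w' : Pt d)) (S + 2 * w') n := by
  have h' : (w : ℤ) ≤ w' := by exact_mod_cast h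
  exact box_subset_box_of_corner L (fun i => by simp only [Pi.sub_apply, Pi.natCast_apply]; linarith)
    (fun i => by simp only [Pi.sub_apply, Pi.natCast_apply]; push_cast; linarith) n

/-- **THE WIDENED PRINT BOX IS THE DEPTH-`n` MARGIN BOX OF `B8Eq131Cubes` WITH MARGIN `Lⁿ·w`**: `x ∈ box L (c − w) (S + 2w) n ↔ InBox (bLo L c n (Lⁿw)) (bHi L c S n (Lⁿw)) x`.
[cite: Balaban1985RegularSpaces, p.98 («for every j the cube □_j is a sum of the big blocks»; bookkeeping)] -/
theorem mem_wbox_iff_inBox_margin (L : ℕ) (c : Pt d) (S n w : ℕ) (x : Pt d) :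
    x ∈ box L (c - (w : Pt d)) (S + 2 * w) n ↔ InBox (bLo L c n (L ^ n * w)) (bHi L c S n (L ^ n * w)) x := by
  have e1 : bLo L (c - (w : Pt d)) n 0 = bLo L c n (L ^ n * w) := by
    funext i; simp only [bLo, Pi.sub_apply, Pi.natCast_apply]; push_cast; ring
  have e2 : bHi L (c - (w : Pt d)) (S + 2 * w) n 0 = bHi L c S n (L ^ n * w) := by
    funext i; simp only [bHi, Pi.sub_apply, Pi.natCast_apply]; push_cast; ring
  show InBox (bLo L (c - (w : Pt d)) n 0) (bHi L (c - (w : Pt d)) (S + 2 * w) n 0) x ↔ _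
  rw [e1, e2]

/-- At width `w = ρ` the widened print box is print's `□_n` traced on the fine lattice (`B8Eq131Cubes.cube L c S ρ n n`, margin `ρ·gs L 0 = ρ`).
[cite: Balaban1985RegularSpaces, p.98 («□_k ⊃ □ … a distance between boundaries … R₁M₁Lʲη»)] -/
theorem wbox_rho_eq_cube_top (L : ℕ) (c : Pt d) (S ρ n : ℕ) : box L (c - (ρ : Pt d)) (S + 2 * ρ) n = cube L c S ρ n n := by
  ext x
  rw [mem_wbox_iff_inBox_margin, B8Eq131Cubes.cube_eq le_rfl, Nat.sub_self, B8Eq131Cubes.gs_zero, mul_one]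
  rfl

/-- ★ **AT WIDTH `w = 2ρ` THE WIDENED PRINT BOX IS PRINT's MARGIN CUBE «□̃» BY NAME** (`B8Eq131Cubes.tcube L c S ρ n`: «a cube with dist(□̃ boundary, □) = 2R₁M₁», [15] (144)
«dist(□̃, □ᶜ) = 2K₁M₁Lʲη»). [cite: Balaban1985Variational, (144) p.300; Balaban1985RegularSpaces, p.98 («A distance of its boundary to □ is equal to 2R₁M₁»)] -/
theorem wbox_two_mul_eq_tcube (L : ℕ) (c : Pt d) (S ρ n : ℕ) : box L (c - ((2 * ρ : ℕ) : Pt d)) (S + 2 * (2 * ρ)) n = tcube L c S ρ n := by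
  ext x
  rw [mem_wbox_iff_inBox_margin, B8Eq131Cubes.tcube_eq]
  rfl

/-- **THE CHART's TOP BOX LIES IN «□̃»** (`1 ≤ ρ`): the print box widened by `ρ + 1` blocks — the fine trace of the chart's top box `[sqLo_n − 1, sqHi_n + 1]`, on which MODULE 62's letter
`δ̂` is read — lies in the print box widened by `2ρ`. [cite: Balaban1985Variational, (144) p.300, (160) p.303; Balaban1985RegularSpaces, p.98] -/
theorem chartTopBox_subset_wboxPrint (L : ℕ) (c : Pt d) (S n : ℕ) {ρ : ℕ} (hρ : 1 ≤ ρ) :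
    box L (c - ((ρ + 1 : ℕ) : Pt d)) (S + 2 * (ρ + 1)) n ⊆ box L (c - ((2 * ρ : ℕ) : Pt d)) (S + 2 * (2 * ρ)) n :=
  wbox_mono L c S n (by omega)

/-- `bLo … m − 1 = bLo … (m + 1)` (bookkeeping). [folklore] -/
private theorem bLo_sub_one (L : ℕ) (c : Pt d) (n m : ℕ) : bLo L c n m - 1 = bLo L c n (m + 1) := by
  funext i; simp only [bLo, Pi.sub_apply, Pi.one_apply]; push_cast; ring

/-- `bHi … m + 1 = bHi … (m + 1)` (bookkeeping). [folklore] -/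
private theorem bHi_add_one (L : ℕ) (c : Pt d) (S n m : ℕ) : bHi L c S n m + 1 = bHi L c S n (m + 1) := by
  funext i; simp only [bHi, Pi.add_apply, Pi.one_apply]; push_cast; ring

/-- ★ **THE CHART's BOX AT EVERY LEVEL LIES IN «□̃»** (`2 ≤ L`, `1 ≤ ρ`, `j′ ≤ n`): the level-`j′` chart box `[sqLo L c ρ n j′ − 1, sqHi L c S ρ n j′ + 1]` (= `□_{j′}^{(j′)}` widened by
one level-`j′` block), blown up to the fine lattice (`tlo ∕ thi` by `j′` levels), lies in the print box widened by `2ρ` level-`n` blocks — since its margin is `L^{j′}·(ρ·gs L (n − j′) + 1)`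
and `ρ·gs L (n − j′) + 1 ≤ 2ρ·L^{n−j′}` ([6] p. 98: «Σ_j R₁M₁Lʲη < (1 − L⁻¹)⁻¹R₁M₁ ≤ 2R₁M₁»). [cite: Balaban1985RegularSpaces, p.98; Balaban1985Variational, (144) p.300] -/
theorem blowup_chartBox_subset_wboxPrint {L : ℕ} (hL : 2 ≤ L) (c : Pt d) (S : ℕ) {ρ : ℕ} (hρ : 1 ≤ ρ) {n j' : ℕ} (hj : j' ≤ n) {x : Pt d}
    (hx : InBox (tlo L (sqLo L c ρ n j' - 1) j') (thi L (sqHi L c S ρ n j' + 1) j') x) :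
    x ∈ box L (c - ((2 * ρ : ℕ) : Pt d)) (S + 2 * (2 * ρ)) n := by
  rw [mem_wbox_iff_inBox_margin]
  have e1 : tlo L (sqLo L c ρ n j' - 1) j' = bLo L c n (L ^ j' * (ρ * gs L (n - j') + 1)) := by
    rw [sqLo, bLo_sub_one, B8Eq131Cubes.tlo_bLo, Nat.sub_add_cancel hj]
  have e2 : thi L (sqHi L c S ρ n j' + 1) j' = bHi L c S n (L ^ j' * (ρ * gs L (n - j') + 1)) := by
    rw [sqHi, bHi_add_one, B8Eq131Cubes.thi_bHi, Nat.sub_add_cancel hj]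
  rw [e1, e2] at hx
  refine B8Eq131Cubes.inBox_margin_mono ?_ hx
  -- `L^{j′}·(ρ·gs L (n − j′) + 1) ≤ Lⁿ·2ρ`
  have h1 : ρ * gs L (n - j') + 1 ≤ L ^ (n - j') * (2 * ρ) := by
    have h2 : gs L (n - j') + 1 ≤ 2 * L ^ (n - j') := B8Ineq132.geom_margin hL (n - j')
    nlinarith
  calc L ^ j' * (ρ * gs L (n - j') + 1) ≤ L ^ j' * (L ^ (n - j') * (2 * ρ)) := Nat.mul_le_mul_left _ h1
    _ = L ^ n * (2 * ρ) := by rw [← mul_assoc, ← pow_add, Nat.add_sub_cancel' hj]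

variable {P : Params}

/-- ★★ **THE BLOCK TOLERANCE OF THE LEVEL RAISING, ANY WIDTH** (`1 ≤ Mc ≤ ρ`, `2w + 2ρ ≤ ρ·L + 1`): the level-`n` print box widened by `w` blocks lies in a level-`(n+1)` print box of the
same letters.  With `cornerP Mc ρ a = ρ·q`, take the level-`(n+1)` index `a⁺_i := ⌊(ρ·t_i + Mc − 1)∕Mc⌋`, `t_i := ⌊(ρq_i − w)∕(Lρ)⌋`; its print corner is `ρ·t` (`Mc ≤ ρ`),
`L·ρt ≤ ρq − w` always, and `ρq − w + ρs + 2w ≤ L·(ρt + ρs)` from `ρq − w < Lρ(t + 1)` as soon as `2w ≤ ρ((L−1)(s−1) − 1) + 1` (`sideP = ρ·s`, `s ≥ 2`), implied by `2w + 2ρ ≤ ρL + 1`.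
[cite: Balaban1985Variational, (144) p.300 (the margin cube □̃); Balaban1985RegularSpaces, p.98] -/
theorem exists_cornerP_wbox_subset_succ_of_width {Mc ρ w : ℕ} (hMc : 1 ≤ Mc) (hMcρ : Mc ≤ ρ) (hw : 2 * w + 2 * ρ ≤ ρ * P.L + 1) (a : Pt P.d) (n : ℕ) :
    ∃ a' : Pt P.d, box P.L (cornerP P Mc ρ a - (w : Pt P.d)) (sideP P Mc ρ + 2 * w) n ⊆ box P.L (cornerP P Mc ρ a') (sideP P Mc ρ) (n + 1) := by
  have hρ0 : (0 : ℤ) < ρ := by exact_mod_cast (lt_of_lt_of_le hMc hMcρ)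
  have hMc0 : (0 : ℤ) < Mc := by exact_mod_cast hMc
  have hL1 : 1 ≤ P.L := by
    -- `2w + 2ρ ≤ ρL + 1` with `ρ ≥ 1` forces `L ≥ 1` (for `L = 0`: `2ρ ≤ 1`)
    rcases Nat.eq_zero_or_pos P.L with h | h
    · rw [h, mul_zero] at hw
      have hρ1 : 1 ≤ ρ := le_trans hMc hMcρ
      omega
    · exact h
  have hL0 : (0 : ℤ) < P.L := by exact_mod_cast hL1
  have hLρ0 : (0 : ℤ) < (P.L : ℤ) * ρ := mul_pos hL0 hρ0
  have hw' : 2 * (w : ℤ) + 2 * ρ ≤ (ρ : ℤ) * P.L + 1 := by exact_mod_cast hw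
  -- the letters
  set q : Pt P.d := fun i => ((Mc : ℤ) * a i) / (ρ : ℤ) with hq
  set t : Pt P.d := fun i => ((ρ : ℤ) * q i - w) / ((P.L : ℤ) * ρ) with ht
  set a' : Pt P.d := fun i => ((ρ : ℤ) * t i + (Mc : ℤ) - 1) / (Mc : ℤ) with ha'
  -- the new corner is `ρ·t`
  have hcorner : ∀ i, cornerP P Mc ρ a' i = (ρ : ℤ) * t i := by
    intro i
    have hlo : (ρ : ℤ) * t i ≤ (Mc : ℤ) * a' i := by
      have := Int.lt_ediv_add_one_mul_self ((ρ : ℤ) * t i + (Mc : ℤ) - 1) hMc0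
      simp only [ha'] at this ⊢
      nlinarith
    have hhi : (Mc : ℤ) * a' i < (ρ : ℤ) * (t i + 1) := by
      have := Int.ediv_mul_le ((ρ : ℤ) * t i + (Mc : ℤ) - 1) hMc0.ne'
      simp only [ha'] at this ⊢
      have hMcρ' : (Mc : ℤ) ≤ ρ := by exact_mod_cast hMcρ
      nlinarith
    have h1 : t i ≤ (Mc : ℤ) * a' i / (ρ : ℤ) := Int.le_ediv_of_mul_le hρ0 ((mul_comm _ _).trans_le hlo)
    have h2 : (Mc : ℤ) * a' i / (ρ : ℤ) < t i + 1 := Int.ediv_lt_of_lt_mul hρ0 (hhi.trans_eq (mul_comm _ _))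
    have h3 : (Mc : ℤ) * a' i / (ρ : ℤ) = t i := by omega
    simp only [cornerP, gridFloor, h3]
  have hcorner0 : ∀ i, cornerP P Mc ρ a i = (ρ : ℤ) * q i := fun i => by simp only [cornerP, gridFloor, hq]
  -- the side is `ρ·s`, `s ≥ 2`
  obtain ⟨s, hs2, hside⟩ : ∃ s : ℕ, 2 ≤ s ∧ sideP P Mc ρ = ρ * s := ⟨(Mc + 11 * P.d) / ρ + 2, le_add_left (le_refl _), rfl⟩
  refine ⟨a', box_subset_box_succ_of_corner P.L (fun i => ?_) (fun i => ?_) n⟩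
  · -- `L·ρt ≤ ρq − w` from `(Lρ)·⌊(ρq − w)/(Lρ)⌋ ≤ ρq − w`
    rw [hcorner, Pi.sub_apply, hcorner0, Pi.natCast_apply]
    have h1 := Int.ediv_mul_le ((ρ : ℤ) * q i - w) hLρ0.ne'
    simp only [ht]
    nlinarith
  · -- `ρq − w + (ρs + 2w) ≤ L(ρt + ρs)` from `ρq − w < (⌊(ρq − w)/(Lρ)⌋ + 1)·Lρ` and the tolerance `2w + ρs + Lρ ≤ Lρs + 1`
    rw [hcorner, Pi.sub_apply, hcorner0, Pi.natCast_apply, hside]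
    push_cast
    have h1 : (ρ : ℤ) * q i - w < (((ρ : ℤ) * q i - w) / ((P.L : ℤ) * ρ) + 1) * ((P.L : ℤ) * ρ) :=
      Int.lt_ediv_add_one_mul_self ((ρ : ℤ) * q i - w) hLρ0
    simp only [ht]
    have hs2' : (2 : ℤ) ≤ s := by exact_mod_cast hs2
    have hL1' : (1 : ℤ) ≤ P.L := by exact_mod_cast hL1
    -- `ρ((L−1)(s−1) − 1) ≥ ρ(L − 2)` for `s ≥ 2`, `L ≥ 1` (the difference is `ρ(L−1)(s−2)`)
    have hkey : (ρ : ℤ) * (P.L - 2) ≤ (ρ : ℤ) * ((P.L - 1) * (s - 1) - 1) :=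
      mul_le_mul_of_nonneg_left (by nlinarith [mul_nonneg (sub_nonneg.mpr hL1') (sub_nonneg.mpr hs2')]) hρ0.le
    nlinarith

end Boxes

/-! ## §2  The reduction: all meeting datums from the width-`w` MARGIN-CLEAN meeting datums -/

section Reduction

variable {P : Params} {N : ℕ}

/-- ★★★ **ALL DATUMS FROM THE WIDTH-`w` MARGIN-CLEAN DATUMS** (generic torus `P`, any region sequence `Ω`, any field `U`, any width `w`): if the split clause holds at every datum `(j, a)`,
`1 ≤ j ≤ k`, whose print box comes within `3` of `Ω_j` AND is MARGIN-CLEAN at width `w` (`j = k`, or the print box WIDENED BY `w` LEVEL-`j` BLOCKS carries no point of `Ω_{j+1}` — at `w = 2ρ`: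
print's «□̃» misses `Ω_{j+1}`, «□̃ ⊂ B^{j−1}(Λ_{j−1}) ∪ B^j(Λ_j)»), and every `w`-widened level-`j` print box lies in a level-`(j+1)` print box, then the clause holds at EVERY datum whose box
comes within `3` of `Ω_j` (induction on `k − j`; MODULE 56 `.raise`). [cite: Balaban1985Variational, (144) p.300, p.300 («□ intersecting Ω_j but not Ω_{j+1}»), (147)–(150) p.301, (160) p.303, (165)–(168) p.304] -/
theorem localGaugeSplitOn_allDatums_of_marginClean_width (hL : 2 ≤ P.L) {Mc ρ : ℕ} (w : ℕ) (Ω : ℕ → Set (Site P 0)) (k : ℕ) (ε δ : ℕ → ℝ)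
    {κ C θ Q : ℝ} (hκ : 0 ≤ κ) (hC : 0 ≤ C) (hθ : 0 ≤ θ) (hQ : 0 ≤ Q)
    (hε0 : ∀ n, n ≤ k → 0 ≤ ε n) (hδ0 : ∀ n, n ≤ k → 0 ≤ δ n)
    (hεcomp' : ∀ n, n < k → ε (n + 1) ≤ 2 * ε n) (hδcomp' : ∀ n, n < k → δ (n + 1) ≤ 2 * δ n)
    (U : GaugeField P 0 (SU N))
    (hnest : ∀ j, 1 ≤ j → j < k → ∀ a : Pt P.d, (∃ z ∈ box P.L (cornerP P Mc ρ a - (w : Pt P.d)) (sideP P Mc ρ + 2 * w) j, cover P z ∈ Ω (j + 1)) →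
      ∃ a' : Pt P.d, box P.L (cornerP P Mc ρ a - (w : Pt P.d)) (sideP P Mc ρ + 2 * w) j ⊆ box P.L (cornerP P Mc ρ a') (sideP P Mc ρ) (j + 1))
    (hclean : ∀ j, 1 ≤ j → j ≤ k → ∀ a : Pt P.d,
      (∃ x ∈ box P.L (cornerP P Mc ρ a) (sideP P Mc ρ) j, ∃ y : Pt P.d, cover P y ∈ Ω j ∧ Within ((3 : ℕ) : ℤ) x y) →
      (j = k ∨ ∀ z ∈ box P.L (cornerP P Mc ρ a - (w : Pt P.d)) (sideP P Mc ρ + 2 * w) j, cover P z ∉ Ω (j + 1)) →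
      LocalGaugeSplitOn (cover P '' box P.L (cornerP P Mc ρ a) (sideP P Mc ρ) j) (P.eta j) (κ * ε j) (C * δ j + θ * ε j + Q * ε j ^ 2) U) :
    ∀ j, 1 ≤ j → j ≤ k → ∀ a : Pt P.d,
      (∃ x ∈ box P.L (cornerP P Mc ρ a) (sideP P Mc ρ) j, ∃ y : Pt P.d, cover P y ∈ Ω j ∧ Within ((3 : ℕ) : ℤ) x y) →
      LocalGaugeSplitOn (cover P '' box P.L (cornerP P Mc ρ a) (sideP P Mc ρ) j) (P.eta j) (κ * ε j) (C * δ j + θ * ε j + Q * ε j ^ 2) U := by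
  -- induction on the co-level `r = k − j`
  suffices H : ∀ r j, k - j = r → 1 ≤ j → j ≤ k → ∀ a : Pt P.d,
      (∃ x ∈ box P.L (cornerP P Mc ρ a) (sideP P Mc ρ) j, ∃ y : Pt P.d, cover P y ∈ Ω j ∧ Within ((3 : ℕ) : ℤ) x y) →
      LocalGaugeSplitOn (cover P '' box P.L (cornerP P Mc ρ a) (sideP P Mc ρ) j) (P.eta j) (κ * ε j) (C * δ j + θ * ε j + Q * ε j ^ 2) U from
    fun j hj hjk a hmeet => H (k - j) j rfl hj hjk a hmeet
  intro r
  induction r with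
  | zero =>
      intro j hr hj hjk a hmeet
      exact hclean j hj hjk a hmeet (Or.inl (by omega))
  | succ r ih =>
      intro j hr hj hjk a hmeet
      by_cases hin : ∃ z ∈ box P.L (cornerP P Mc ρ a - (w : Pt P.d)) (sideP P Mc ρ + 2 * w) j, cover P z ∈ Ω (j + 1)
      · -- the WIDENED box meets `Ω_{j+1}`: raise the level (block tolerance: the widened box lies in a level-`(j+1)` print box)
        have hjk' : j < k := by omega
        obtain ⟨a', hsub⟩ := hnest j hj hjk' a hin
        obtain ⟨z, hz, hzΩ⟩ := hin
        have hmeet' : ∃ x ∈ box P.L (cornerP P Mc ρ a') (sideP P Mc ρ) (j + 1), ∃ y : Pt P.d, cover P y ∈ Ω (j + 1) ∧ Within ((3 : ℕ) : ℤ) x y :=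
          ⟨z, hsub hz, z, hzΩ, Within.refl (by norm_num) z⟩
        have hup := ih (j + 1) (by omega) (by omega) (by omega) a' hmeet'
        exact hup.raise (Set.image_mono ((box_subset_wbox_width P.L _ _ j w).trans hsub)) hL j hκ hC hθ hQ (hε0 j hjk) (hδ0 j hjk) (hε0 (j + 1) (by omega))
          (hεcomp' j hjk') (hδcomp' j hjk')
      · -- width-`w` margin-clean datum
        push Not at hin
        exact hclean j hj hjk a hmeet (Or.inr hin)

/-! ## §3  The guarded token from its width-`w` margin-clean restriction; the PRINT corollary `w = 2ρ` -/

/-- ★★★ **THE GUARDED PER-DATUM TOKEN FROM ITS WIDTH-`w` MARGIN-CLEAN RESTRICTION** — print's «□ intersecting Ω_j but NOT Ω_{j+1}» read with a margin of `w` level-`j` blocks for the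
tree's grid datums: dag-n07-w4's `DatumGaugeSplitTopStepCoreG F N Sup Mc ρ Adm B₃ C θ Q κ a₀ a₁` holds as soon as the SAME clause is supplied under the SAME prefix at the datums whose print box
comes within `3` of `Ω_j` (box form) AND is margin-clean at width `w`: `j = k ∨` «the widened box `box L (cornerP a − w) (sideP + 2w) j` carries no point of `Ω_{j+1}`».  Side letters
`1 ≤ Mc ≤ ρ`, the block tolerance `2w + 2ρ ≤ ρ·L + 1` (§1; in Bałaban's family every `w ≤ 5ρ`), `0 ≤ B₃ κ C θ Q`.
[cite: Balaban1985Variational, p.279 (class of cubes), (144) p.300, p.300 («□ intersecting Ω_j but not Ω_{j+1}»), (147)–(150) p.301, (160) p.303, (165)–(168) p.304, Prop. 8 p.304] -/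
theorem datumGaugeSplitTopStepCoreG_of_marginClean_width (F : T4Family) (N : ℕ) [NeZero N]
    {Sup : (ν : Stage7Numerics) → (K : ℕ) → (ℕ → Set (Site (F.P K) 0)) → Set (Site (F.P K) 0)} {Mc ρ : ℕ} (hMc : 1 ≤ Mc) (hMcρ : Mc ≤ ρ)
    (w : ℕ) (hw : 2 * w + 2 * ρ ≤ ρ * F.L + 1)
    {Adm : StepGuard F} {B₃ C θ Q κ a₀ a₁ : ℝ} (hB₃ : 0 ≤ B₃) (hκ : 0 ≤ κ) (hC : 0 ≤ C) (hθ : 0 ≤ θ) (hQ : 0 ≤ Q)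
    (h : ∀ (ν : Stage7Numerics) (M : ℕ) (g : ℕ → ℝ) (K k : ℕ) (s : SeqOfRecord F ν M g K k), Sect2.SeqSeparated ν.M₁ s → 0 < ν.M₁ → Adm ν M g K k s → 1 ≤ k →
      ∀ (ε δ : ℕ → ℝ),
      (∀ n, n ≤ k → 0 < δ n ∧ δ n ≤ a₁) → (∀ n, n < k → δ n ≤ 2 * δ (n + 1)) → (∀ n, n < k → δ (n + 1) ≤ 2 * δ n) →
      (∀ n, n ≤ k → B₃ * δ n ≤ ε n ∧ ε n ≤ a₀) → (∀ n, n < k → ε n ≤ 2 * ε (n + 1)) → (∀ n, n < k → ε (n + 1) ≤ 2 * ε n) →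
      ∀ W : MSField (F.P K) (SU N), Sect2.DataSmall7PTop (avOfRecord F N K) s.Ω (Sup ν K s.Ω) k δ W →
        ∀ U : GaugeField (F.P K) 0 (SU N),
          (∀ n, n ≤ k → PlaqSmallOn (Sect2.omegaPlaqsTop s.Ω (Sup ν K s.Ω) n) (ε n * (F.P K).eta n ^ 2) U) →
          (∀ n, n ≤ k → Sect2.CoDivSmallOn (Sect2.omegaBondsTop s.Ω (Sup ν K s.Ω) n) (ε n * (F.P K).eta n ^ 3) U) →
          AgreeOn (genSet s.Ω k) (avgFamily (avOfRecord F N K) U) W →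
          IsCritOnFibre F N K (genSet s.Ω k) W U →
          ∀ j, 1 ≤ j → j ≤ k → ∀ a : Pt (F.P K).d,
            (∃ x ∈ box (F.P K).L (cornerP (F.P K) Mc ρ a) (sideP (F.P K) Mc ρ) j, ∃ y : Pt (F.P K).d, cover (F.P K) y ∈ s.Ω j ∧ Within ((3 : ℕ) : ℤ) x y) →
            (j = k ∨ ∀ z ∈ box (F.P K).L (cornerP (F.P K) Mc ρ a - (w : Pt (F.P K).d)) (sideP (F.P K) Mc ρ + 2 * w) j, cover (F.P K) z ∉ s.Ω (j + 1)) →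
            LocalGaugeSplitOn (cover (F.P K) '' box (F.P K).L (cornerP (F.P K) Mc ρ a) (sideP (F.P K) Mc ρ) j)
              ((F.P K).eta j) (κ * ε j) (C * δ j + θ * ε j + Q * ε j ^ 2) U) :
    DatumGaugeSplitTopStepCoreG F N Sup Mc ρ Adm B₃ C θ Q κ a₀ a₁ := by
  intro ν M g K k s hsep hM₁ hadm hk ε δ hδ hcompδ hcompδ' hε hεcomp hεcomp' W h7 U h17 h19 hfib hcrit j hj hjk a hmeet
  have hL2 : 2 ≤ (F.P K).L := by have := F.hL11; rw [T4Family.P_L]; omega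
  have hwK : 2 * w + 2 * ρ ≤ ρ * (F.P K).L + 1 := by rwa [T4Family.P_L]
  have hρ0 : 0 < ρ := lt_of_lt_of_le hMc hMcρ
  have hδ0 : ∀ n, n ≤ k → 0 ≤ δ n := fun n hn => (hδ n hn).1.le
  have hε0 : ∀ n, n ≤ k → 0 ≤ ε n := fun n hn => le_trans (mul_nonneg hB₃ (hδ0 n hn)) (hε n hn).1
  -- the token's meeting premise (grid cube within 3 of `Ω_j`) gives the box premise (`□ ⊆ 𝔔`)
  have hmeet' : ∃ x ∈ box (F.P K).L (cornerP (F.P K) Mc ρ a) (sideP (F.P K) Mc ρ) j, ∃ y : Pt (F.P K).d,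
      cover (F.P K) y ∈ s.Ω j ∧ Within ((3 : ℕ) : ℤ) x y := by
    obtain ⟨x, y, hx, hy, hw3⟩ := hmeet
    exact ⟨x, cubeExt_side_subset_box_cornerP Mc hρ0 a j hx, y, hy, hw3⟩
  exact localGaugeSplitOn_allDatums_of_marginClean_width hL2 w s.Ω k ε δ hκ hC hθ hQ hε0 hδ0 hεcomp' hcompδ' U
    (fun j' _ _ a' _ => exists_cornerP_wbox_subset_succ_of_width hMc hMcρ hwK a' j')
    (h ν M g K k s hsep hM₁ hadm hk ε δ hδ hcompδ hcompδ' hε hεcomp hεcomp' W h7 U h17 h19 hfib hcrit) j hj hjk a hmeet'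

/-- ★★★ **THE GUARDED PER-DATUM TOKEN FROM ITS RESTRICTION TO PRINT's MARGIN-CLEAN DATUMS** (`w = 2ρ`: «□̃ misses Ω_{j+1}», Bałaban's (144) ∕ [6] p. 98 margin `2R₁M₁`; the block
tolerance `6ρ ≤ ρ·L + 1` is automatic from `L > 11`): the token holds as soon as the clause is supplied at the datums whose print box comes within `3` of `Ω_j` AND whose margin cube
`box L (cornerP a − 2ρ) (sideP + 4ρ) j` (= `tcube`, §1) carries no point of `Ω_{j+1}` — a set of datums at which the chart's whole top box (print box + `ρ + 1` blocks, §1) misses `Ω_{j+1}`.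
Side letters `1 ≤ Mc ≤ ρ`, `0 ≤ B₃ κ C θ Q` only. [cite: Balaban1985Variational, p.279 (class of cubes), (144) p.300, p.300 («□ intersecting Ω_j but not Ω_{j+1}»), (147)–(150) p.301, (160) p.303, (165)–(168) p.304, Prop. 8 p.304; Balaban1985RegularSpaces, p.98] -/
theorem datumGaugeSplitTopStepCoreG_of_marginCleanPrint (F : T4Family) (N : ℕ) [NeZero N]
    {Sup : (ν : Stage7Numerics) → (K : ℕ) → (ℕ → Set (Site (F.P K) 0)) → Set (Site (F.P K) 0)} {Mc ρ : ℕ} (hMc : 1 ≤ Mc) (hMcρ : Mc ≤ ρ)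
    {Adm : StepGuard F} {B₃ C θ Q κ a₀ a₁ : ℝ} (hB₃ : 0 ≤ B₃) (hκ : 0 ≤ κ) (hC : 0 ≤ C) (hθ : 0 ≤ θ) (hQ : 0 ≤ Q)
    (h : ∀ (ν : Stage7Numerics) (M : ℕ) (g : ℕ → ℝ) (K k : ℕ) (s : SeqOfRecord F ν M g K k), Sect2.SeqSeparated ν.M₁ s → 0 < ν.M₁ → Adm ν M g K k s → 1 ≤ k →
      ∀ (ε δ : ℕ → ℝ),
      (∀ n, n ≤ k → 0 < δ n ∧ δ n ≤ a₁) → (∀ n, n < k → δ n ≤ 2 * δ (n + 1)) → (∀ n, n < k → δ (n + 1) ≤ 2 * δ n) →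
      (∀ n, n ≤ k → B₃ * δ n ≤ ε n ∧ ε n ≤ a₀) → (∀ n, n < k → ε n ≤ 2 * ε (n + 1)) → (∀ n, n < k → ε (n + 1) ≤ 2 * ε n) →
      ∀ W : MSField (F.P K) (SU N), Sect2.DataSmall7PTop (avOfRecord F N K) s.Ω (Sup ν K s.Ω) k δ W →
        ∀ U : GaugeField (F.P K) 0 (SU N),
          (∀ n, n ≤ k → PlaqSmallOn (Sect2.omegaPlaqsTop s.Ω (Sup ν K s.Ω) n) (ε n * (F.P K).eta n ^ 2) U) →
          (∀ n, n ≤ k → Sect2.CoDivSmallOn (Sect2.omegaBondsTop s.Ω (Sup ν K s.Ω) n) (ε n * (F.P K).eta n ^ 3) U) →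
          AgreeOn (genSet s.Ω k) (avgFamily (avOfRecord F N K) U) W →
          IsCritOnFibre F N K (genSet s.Ω k) W U →
          ∀ j, 1 ≤ j → j ≤ k → ∀ a : Pt (F.P K).d,
            (∃ x ∈ box (F.P K).L (cornerP (F.P K) Mc ρ a) (sideP (F.P K) Mc ρ) j, ∃ y : Pt (F.P K).d, cover (F.P K) y ∈ s.Ω j ∧ Within ((3 : ℕ) : ℤ) x y) →
            (j = k ∨ ∀ z ∈ box (F.P K).L (cornerP (F.P K) Mc ρ a - ((2 * ρ : ℕ) : Pt (F.P K).d)) (sideP (F.P K) Mc ρ + 2 * (2 * ρ)) j, cover (F.P K) z ∉ s.Ω (j + 1)) →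
            LocalGaugeSplitOn (cover (F.P K) '' box (F.P K).L (cornerP (F.P K) Mc ρ a) (sideP (F.P K) Mc ρ) j)
              ((F.P K).eta j) (κ * ε j) (C * δ j + θ * ε j + Q * ε j ^ 2) U) :
    DatumGaugeSplitTopStepCoreG F N Sup Mc ρ Adm B₃ C θ Q κ a₀ a₁ :=
  -- print's width `w = 2ρ`: `2·(2ρ) + 2ρ = 6ρ ≤ ρ·L + 1` since `L > 11`
  datumGaugeSplitTopStepCoreG_of_marginClean_width F N hMc hMcρ (2 * ρ)
    (by have := F.hL11; nlinarith) hB₃ hκ hC hθ hQ h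

end Reduction

end Summit.QuantumFields.YangMills.BalabanUVNodes.N07SplitClauseLevelRaisingMarginWide

end
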